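import Summits.BirchSwinnertonDyer.BirchSwinnertonDyer.Theorems.GenusKolyvaginAtTwoGenusPrimitiveSupplyAtTwoLocalTwoTorsion
import Literature.NumberTheory.EllipticCurves.MazurRubin2010.TwistSelmerRankControl
import Literature.NumberTheory.QuadraticFields.ImaginaryQuadraticPrescribedSplitting
import Literature.NumberTheory.QuadraticFields.ThreeTorsion
import Literature.NumberTheory.EllipticCurves.GlobalMinimalModelProofs
import Literature.NumberTheory.EllipticCurves.QuadraticTwist
import HarnessLib

/-!
# Route `GenusKolyvaginAtTwo`, crux `GenusPrimitiveSupplyAtTwo` (stmt-BirchSwinnertonDyer-22136):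
# PRIME Heegner fields — `DEF = 1` for free on `Δ < 0`, and the `2`-Selmer twin comparison (SUPPLY″-Selmer)

Seat `bsd-line-gk2-p5` g6 (cell `bsd-f1-sign2`), SUPPLY lineage (g0 `…TwinSupply*.lean`, g2 `…HeegnerTwin*.lean`, g6
`…LocalTwoTorsion.lean`). Summit-side THEOREM-ONLY file (no definition, no named fact, no `sorry`),
`--supports stmt-BirchSwinnertonDyer-22136`, route-independent imports.

CONTEXT (REPAIR CENSUS v1.2 §6 of the lead bsd-line-gk2-p1; lead g4 verdict on item 24947, 04:57Z): the line's open kernel U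
(`MultiGenusPrimitivityAtTwo`) must be re-typed with «DEF(W, d_K) = 1» or in ∃K-form, and the line then needs the supply
SUPPLY″ = «an admissible Heegner field K with DEF(E,K) = 1 and a (Sel₂-minimal) rank-one twin E^{(d_K)}». Here
`DEF(E,K) = Σ_{q ∣ d_K} dim Ẽ(𝔽_q)[2] + [Δ_E > 0]`, in root-count currency: a prime `q ∣ d_K` is a TRANSPOSITION prime if the
`2`-division cubic `ψ` of the minimal model has exactly one root mod `q`, SILENT if it has none.

THIS FILE, for a PRIME Heegner field `K = ℚ(√−ℓ)` (`d_K = −ℓ`, odd, Heegner for `N_W`):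
* §1 `(Δ_min(W) / ℓ) = sign Δ_W` (Jacobi, g2's `jacobiSym_minimalDiscriminantInt_natAbs_discr` with ONE prime); hence on
  `Δ_W < 0` the unique prime of `d_K` is a transposition prime — **DEF(W,K) = 1 AUTOMATICALLY** — and `#E(ℚ_ℓ)[2] = 2`
  (g6 Hensel bridge); on `Δ_W > 0` it is NOT a transposition prime (silent or split; DEF ∈ {1, 3}).
* §2 Mazur–Rubin 2010 Prop. 3.3 (tree NAMED FACT `MazurRubin2010.prop33_rat`, PRINT, taken as a hypothesis `h33`) in the
  cell's ROOT-COUNT currency, for any odd-`d_K` Heegner field on `Δ_W < 0` with `2` split: if `T` is a set of transposition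
  primes of `d_K` and every other prime of `d_K` is silent, then `#Sel₂(E^{(d_K)}) ∣ 2^{#T}·#Sel₂(E)`,
  `#Sel₂(E) ∣ 2^{#T}·#Sel₂(E^{(d_K)})`, and `#T` is even iff the product is a square (`prop33_twin_of_rootCount`). The
  splitting list of Prop. 3.3 is discharged from the Heegner hypothesis (every bad prime divides `N_W`, hence splits and
  is unramified in `K`) and `Δ_W < 0` (the real place carries no condition).
* §3 prime `d_K = −ℓ`, `Δ_W < 0`, `2` split (`ℓ ≡ 7 (mod 8)`, automatic when `2 ∣ N_W`): `T = {ℓ}`, so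
  **`#Sel₂(E) = 1 ⟹ #Sel₂(E^{(−ℓ)}) = 2`** (`natCard_selmerGroup_twin_eq_two_of_prime_heegner`) — on the cell
  {Δ < 0, Ш(E)[2] = 0, E(ℚ)[2] = 0} EVERY such prime Heegner field supplies a Sel₂-MINIMAL twin with DEF = 1, mod PRINT —
  and conversely **`#Sel₂(E^{(−ℓ)}) = 2 ⟹ #Sel₂(E) ∈ {1, 4}`** (`natCard_selmerGroup_eq_one_or_four_of_prime_heegner_twin`):
  a DEF = 1 Sel₂-minimal genus pair on `Δ < 0` lives on `#Ш(E)[2]·#E(ℚ)[2]² ≤ 4` (the V6 + «DEF = 1» line's Selmer reach;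
  the Selmer-free V12 is not bounded by this).
* §4 EXISTENCE (unconditional, Dirichlet): every globally minimal elliptic `W/ℚ` has, beyond any bound, prime Heegner
  fields `K = ℚ(√−ℓ)` with ALL the K-clauses of crux 22136 (imaginary quadratic, `d_K` odd `≠ −3`, Heegner for `N_W`,
  `d_K·(−|Δ|)` and `d_K·(−2|Δ|)` non-squares) AND `2` split (`exists_prime_heegnerField`); with §3, modulo `prop33_rat`
  only: **SUPPLY″-Selmer on {Δ < 0, #Sel₂(E) = 1}** (`exists_prime_heegnerField_minimalTwin_of_prop33`) — a DEF = 1 admissible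
  Heegner field together with a globally minimal Sel₂-minimal twin, `K` free among infinitely many (room for Čebotarev
  side conditions). The twin's analytic rank one is NOT asserted here (it is the rank-one `2`-converse, crux 19220, after
  `2`-parity; or Gross–Zagier–Kolyvagin for the pair).

References: [MazurRubin2010] Prop. 3.3, Cor. 3.4, Lemma 2.2 (i); [IrelandRosen1990] Prop. 5.2.2; [SilvermanAEC2009] VII.3,
VIII.8; [GrossLMS1991] §1 (Heegner hypothesis). No item is closed by this file; BSD is not proved by any of this.
-/

set_option linter.dupNamespace false -- tree convention: `Summit.BirchSwinnertonDyer.BirchSwinnertonDyer.Theorems` (summit = sub-problem)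
set_option autoImplicit false

noncomputable section

open scoped Classical

open NumberField WeierstrassCurve Literature.NumberTheory.EllipticCurves Literature.NumberTheory.QuadraticFields

namespace Summit.BirchSwinnertonDyer.BirchSwinnertonDyer.Theorems.GenusKolyTwin

variable (W : WeierstrassCurve ℚ) [W.IsElliptic] [W.IsGloballyMinimal] {K : Type} [Field K] [NumberField K]

/-! ## §1. Prime Heegner fields: `(Δ_min / ℓ) = sign Δ`, DEF = 1 for free on `Δ < 0` -/

/-- A prime `ℓ` with `d_K = −ℓ`, `d_K` odd and `K` Heegner for `N_W`: `ℓ ≠ 2`, `ℓ ∤ N_W`, `ℓ ∤ Δ_min(W)` (a prime of `d_K`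
ramifies in `K`, the primes of `N_W ⊇ supp Δ_min` split). [cite: GrossLMS1991, §1 (p. 235)] -/
theorem prime_discr_facts (hK : IsImaginaryQuadratic K) (hodd : Odd (discr K))
    (hH : SatisfiesHeegnerHypothesis (W.conductorNorm ℤ) K) {ℓ : ℕ} (hℓ : ℓ.Prime) (hd : discr K = -(ℓ : ℤ)) :
    ℓ ≠ 2 ∧ ¬ ℓ ∣ W.conductorNorm ℤ ∧ ¬ (ℓ : ℤ) ∣ minimalDiscriminantInt W := by
  have hℓd : (ℓ : ℤ) ∣ discr K := ⟨-1, by rw [hd]; ring⟩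
  have hℓ2 : ℓ ≠ 2 := by
    rintro rfl
    exact (Int.not_even_iff_odd.mpr hodd) (even_iff_two_dvd.mpr (by exact_mod_cast hℓd))
  have hℓN : ¬ ℓ ∣ W.conductorNorm ℤ := fun hℓN =>
    Literature.SatisfiesHeegnerHypothesis.not_dvd_discr hK.1 hH hℓ hℓN hℓd
  exact ⟨hℓ2, hℓN, fun hℓΔ => hℓN (dvd_conductorNorm_of_dvd_minimalDiscriminantInt W hℓ hℓΔ)⟩

/-- **`(Δ_min(W) / ℓ) = sign Δ_W` for a prime Heegner field `K = ℚ(√−ℓ)`** (`d_K = −ℓ` odd, Heegner for `N_W`): the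
one-prime case of `(Δ_min | |d_K|) = sign Δ_min`. [cite: IrelandRosen1990, Prop. 5.2.2] -/
theorem jacobiSym_minimalDiscriminantInt_eq_sign_of_discr_eq_neg_prime (hK : IsImaginaryQuadratic K)
    (hodd : Odd (discr K)) (hH : SatisfiesHeegnerHypothesis (W.conductorNorm ℤ) K) {ℓ : ℕ}
    (hd : discr K = -(ℓ : ℤ)) :
    jacobiSym (minimalDiscriminantInt W) ℓ = (minimalDiscriminantInt W).sign := by
  have h := jacobiSym_minimalDiscriminantInt_natAbs_discr W hK hodd hH
  rwa [hd, Int.natAbs_neg, Int.natAbs_natCast] at h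

/-- **DEF = 1 for free on `Δ < 0`.** For a prime Heegner field `K = ℚ(√−ℓ)` of a globally minimal `W` with `Δ_W < 0`, the
`2`-division cubic `ψ = 4x³ + b₂x² + 2b₄x + b₆` of the minimal model has EXACTLY ONE root mod `ℓ`: the unique prime of
`d_K` is a transposition prime, i.e. `DEF(W,K) = Σ_{q∣d_K} dim Ẽ(𝔽_q)[2] + [Δ>0] = 1`.
[cite: IrelandRosen1990, Prop. 5.2.2] [cite: SilvermanAEC2009, III.1 (ψ₂, Δ)] -/
theorem existsUnique_zmod_root_of_discr_eq_neg_prime_of_Δ_neg (hK : IsImaginaryQuadratic K) (hodd : Odd (discr K))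
    (hH : SatisfiesHeegnerHypothesis (W.conductorNorm ℤ) K) {ℓ : ℕ} [Fact ℓ.Prime] (hd : discr K = -(ℓ : ℤ))
    (hΔ : W.Δ < 0) :
    ∃! x : ZMod ℓ, 4 * x ^ 3 + ((integralModelInt W).b₂ : ZMod ℓ) * x ^ 2 +
      2 * ((integralModelInt W).b₄ : ZMod ℓ) * x + ((integralModelInt W).b₆ : ZMod ℓ) = 0 := by
  obtain ⟨hℓ2, -, hℓΔ⟩ := prime_discr_facts W hK hodd hH (Fact.out) hd
  rw [existsUnique_zmod_root_twoTorsion_iff_jacobiSym_eq_neg_one W hℓ2 hℓΔ,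
    jacobiSym_minimalDiscriminantInt_eq_sign_of_discr_eq_neg_prime W hK hodd hH hd]
  exact (sign_minimalDiscriminantInt_eq_neg_one_iff W).mpr hΔ

/-- On `Δ_W > 0` the unique prime `ℓ` of a prime Heegner field is NOT a transposition prime (`(Δ_min/ℓ) = +1`: `ψ` has no
root or three roots mod `ℓ`; DEF ∈ {1, 3}). [cite: IrelandRosen1990, Prop. 5.2.2] -/
theorem not_existsUnique_zmod_root_of_discr_eq_neg_prime_of_Δ_pos (hK : IsImaginaryQuadratic K) (hodd : Odd (discr K))
    (hH : SatisfiesHeegnerHypothesis (W.conductorNorm ℤ) K) {ℓ : ℕ} [Fact ℓ.Prime] (hd : discr K = -(ℓ : ℤ))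
    (hΔ : 0 < W.Δ) :
    ¬ ∃! x : ZMod ℓ, 4 * x ^ 3 + ((integralModelInt W).b₂ : ZMod ℓ) * x ^ 2 +
      2 * ((integralModelInt W).b₄ : ZMod ℓ) * x + ((integralModelInt W).b₆ : ZMod ℓ) = 0 := by
  obtain ⟨hℓ2, -, hℓΔ⟩ := prime_discr_facts W hK hodd hH (Fact.out) hd
  rw [existsUnique_zmod_root_twoTorsion_iff_jacobiSym_eq_neg_one W hℓ2 hℓΔ,
    jacobiSym_minimalDiscriminantInt_eq_sign_of_discr_eq_neg_prime W hK hodd hH hd, Int.sign_eq_neg_one_iff_neg, not_lt]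
  have h0 : (0 : ℚ) ≤ (minimalDiscriminantInt W : ℚ) := by rw [cast_minimalDiscriminantInt]; exact hΔ.le
  exact_mod_cast h0

/-- **`#E(ℚ_ℓ)[2] = 2` at the prime of a prime Heegner field on `Δ < 0`**: `ℓ` is a `T`-prime in the sense of
Mazur–Rubin 2010 Prop. 3.3 (`MazurRubin2010.prop33_rat`). [cite: MazurRubin2010, Lemma 2.2 (i) and Prop. 3.3] -/
theorem natCard_twoTorsion_padic_eq_two_of_discr_eq_neg_prime (hK : IsImaginaryQuadratic K) (hodd : Odd (discr K))
    (hH : SatisfiesHeegnerHypothesis (W.conductorNorm ℤ) K) {ℓ : ℕ} [Fact ℓ.Prime] (hd : discr K = -(ℓ : ℤ))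
    (hΔ : W.Δ < 0) :
    Nat.card {Q : (W.baseChange ℚ_[ℓ]).toAffine.Point // 2 • Q = 0} = 2 := by
  obtain ⟨hℓ2, -, hℓΔ⟩ := prime_discr_facts W hK hodd hH (Fact.out) hd
  exact natCard_twoTorsion_padic_eq_two_of_existsUnique W hℓ2 hℓΔ
    (existsUnique_zmod_root_of_discr_eq_neg_prime_of_Δ_neg W hK hodd hH hd hΔ)

/-! ## §2. Mazur–Rubin Prop. 3.3 for Heegner twins in root-count currency -/

/-- **Mazur–Rubin 2010 Prop. 3.3 for an odd-`d_K` Heegner twin on `Δ_W < 0`, in ROOT-COUNT currency** (modulo the PRINT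
named fact `MazurRubin2010.prop33_rat`, hypothesis `h33`). Let `W/ℚ` be globally minimal elliptic with `Δ_W < 0`, `K`
imaginary quadratic with odd `d_K`, Heegner for `N_W`, with `2` split in `K`; let `T` be a finite set of primes of `d_K` at
which the `2`-division cubic `ψ` of the minimal model has EXACTLY ONE root (transposition primes), and suppose `ψ` has NO
root at every other prime of `d_K` (silent primes). Then for every elliptic model `Wd` of the twist `W^{(d_K)}`:
`#Sel₂(Wd) ∣ 2^{#T}·#Sel₂(W)`, `#Sel₂(W) ∣ 2^{#T}·#Sel₂(Wd)`, and `#T` is even iff `#Sel₂(Wd)·#Sel₂(W)` is a square.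
Discharge of the splitting list: additive and multiplicative primes divide `N_W`, hence split (Heegner) and do not divide
`d_K`; the real place carries no condition since `Δ_W < 0`; `√d_K ∈ K`; `T`-primes have `#E(ℚ_p)[2] = 2` and silent primes
`E(ℚ_p)[2] = 0` by the Hensel bridge (`…LocalTwoTorsion`). [cite: MazurRubin2010, Prop. 3.3 with Def. 3.1 and Lemma 2.2 (i)] -/
theorem prop33_twin_of_rootCount (h33 : MazurRubin2010.prop33_rat) (hΔ : W.Δ < 0) (hK : IsImaginaryQuadratic K)
    (hodd : Odd (discr K)) (hH : SatisfiesHeegnerHypothesis (W.conductorNorm ℤ) K)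
    (h2K : ((Ideal.span {(2 : ℤ)}).primesOver (𝓞 K)).ncard = 2) (T : Finset ℕ)
    (hT : ∀ p ∈ T, p.Prime ∧ (p : ℤ) ∣ discr K ∧ ∃! x : ZMod p, 4 * x ^ 3 + ((integralModelInt W).b₂ : ZMod p) * x ^ 2 +
      2 * ((integralModelInt W).b₄ : ZMod p) * x + ((integralModelInt W).b₆ : ZMod p) = 0)
    (hsil : ∀ p : ℕ, p.Prime → (p : ℤ) ∣ discr K → p ∉ T → ∀ x : ZMod p, 4 * x ^ 3 +
      ((integralModelInt W).b₂ : ZMod p) * x ^ 2 + 2 * ((integralModelInt W).b₄ : ZMod p) * x +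
        ((integralModelInt W).b₆ : ZMod p) ≠ 0)
    (Wd : WeierstrassCurve ℚ) [Wd.IsElliptic]
    (hWd : ∃ C : VariableChange ℚ, C • W.quadraticTwist (discr K : ℚ) = Wd) :
    Nat.card (Wd.selmerGroup 2) ∣ 2 ^ T.card * Nat.card (W.selmerGroup 2) ∧
      Nat.card (W.selmerGroup 2) ∣ 2 ^ T.card * Nat.card (Wd.selmerGroup 2) ∧
      (Even T.card ↔ IsSquare (Nat.card (Wd.selmerGroup 2) * Nat.card (W.selmerGroup 2))) := by
  -- facts about `d_K`
  have hneg : discr K < 0 := IsImaginaryQuadratic.discr_neg hK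
  have hsqf : Squarefree (discr K) := by
    rcases Quadratic.isFundamentalDiscriminant_discr (K := K) hK.1 with h | h
    · exact h.2.1
    · exfalso
      obtain ⟨e, he⟩ := h.1
      exact (Int.not_even_iff_odd.mpr hodd) ⟨2 * e, by rw [he]; ring⟩
  have hd1 : discr K ≠ 1 := by omega
  -- `√d_K ∈ K`
  have hsqrt : ∃ x : K, x ^ 2 = ((discr K : ℤ) : K) := by
    obtain ⟨δ, -, hδ⟩ := Quadratic.exists_not_mem_range_sq_eq_discr (K := K) hK.1
    exact ⟨δ, by rw [hδ, map_intCast]⟩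
  -- bad primes divide `N_W`, hence split in `K` and do not divide `d_K`
  have hbad : ∀ (p : ℕ) [Fact p.Prime], ¬ W.HasGoodReductionAtPrime p →
      ((Ideal.span {(p : ℤ)}).primesOver (𝓞 K)).ncard = 2 ∧ ¬ (p : ℤ) ∣ discr K := by
    intro p _ hgood
    have hpN : p ∣ W.conductorNorm ℤ := (W.dvd_conductorNorm_iff_not_hasGoodReductionAtPrime p).mpr hgood
    exact ⟨hH p Fact.out hpN, fun hpd => Literature.SatisfiesHeegnerHypothesis.not_dvd_discr hK.1 hH Fact.out hpN hpd⟩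
  have hmult : ∀ (p : ℕ) [Fact p.Prime], W.HasMultiplicativeReductionAtPrime p → ¬ W.HasGoodReductionAtPrime p :=
    fun p _ h => WeierstrassCurve.HasMultiplicativeReduction.not_hasGoodReduction (R := ℤ_[p]) h
  -- primes of `d_K` are odd, prime to `N_W` and to `Δ_min`
  have hdisc : ∀ p : ℕ, p.Prime → (p : ℤ) ∣ discr K → p ≠ 2 ∧ ¬ (p : ℤ) ∣ minimalDiscriminantInt W := by
    intro p hp hpd
    have hp2 : p ≠ 2 := by
      rintro rfl
      exact (Int.not_even_iff_odd.mpr hodd) (even_iff_two_dvd.mpr (by exact_mod_cast hpd))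
    refine ⟨hp2, fun hpΔ => ?_⟩
    exact Literature.SatisfiesHeegnerHypothesis.not_dvd_discr hK.1 hH hp
      (dvd_conductorNorm_of_dvd_minimalDiscriminantInt W hp hpΔ) hpd
  -- the twin as a model of `W^{(d_K)}`
  obtain ⟨C, hC⟩ := hWd
  have hWd' : ∃ C' : VariableChange ℚ, C' • Wd = W.quadraticTwist ((discr K : ℤ) : ℚ) :=
    ⟨C⁻¹, by rw [← hC, inv_smul_smul]⟩
  refine h33 W (discr K) hsqf hd1 K hK.1 hsqrt (fun p _ hgood _ => (hbad p hgood).1)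
    (fun p _ hm _ => (hbad p (hmult p hm)).1) h2K (fun hpos => absurd hΔ (not_lt.mpr hpos.le))
    (fun p _ hm _ => (hbad p (hmult p hm)).2) T (fun p hp => ?_) (fun p _ hpd hpT => ?_) Wd hWd'
  · obtain ⟨hpp, hpd, huniq⟩ := hT p hp
    obtain ⟨hp2, hpΔ⟩ := hdisc p hpp hpd
    refine ⟨hpp, hpd, fun {_} => ?_⟩
    exact natCard_twoTorsion_padic_eq_two_of_existsUnique W hp2 hpΔ huniq
  · obtain ⟨hp2, hpΔ⟩ := hdisc p Fact.out hpd
    exact twoTorsion_padic_eq_zero_of_forall_ne W hp2 hpΔ (hsil p Fact.out hpd hpT)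

/-! ## §3. Prime Heegner twins: `T = {ℓ}` -/

/-- **The `2`-Selmer comparison for a PRIME Heegner twin on `Δ < 0`** (mod `MazurRubin2010.prop33_rat`): for `d_K = −ℓ`
(odd, Heegner for `N_W`, `2` split in `K`) and any elliptic model `Wd` of `W^{(−ℓ)}`:
`#Sel₂(Wd) ∣ 2·#Sel₂(W)`, `#Sel₂(W) ∣ 2·#Sel₂(Wd)`, and `#Sel₂(Wd)·#Sel₂(W)` is NOT a square (the `2`-Selmer ranks differ by
exactly one). `T = {ℓ}` by §1. [cite: MazurRubin2010, Prop. 3.3 and Cor. 3.4 (i)] -/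
theorem selmer_twin_prime_heegner (h33 : MazurRubin2010.prop33_rat) (hΔ : W.Δ < 0) (hK : IsImaginaryQuadratic K)
    (hodd : Odd (discr K)) (hH : SatisfiesHeegnerHypothesis (W.conductorNorm ℤ) K)
    (h2K : ((Ideal.span {(2 : ℤ)}).primesOver (𝓞 K)).ncard = 2) {ℓ : ℕ} (hℓ : ℓ.Prime) (hd : discr K = -(ℓ : ℤ))
    (Wd : WeierstrassCurve ℚ) [Wd.IsElliptic]
    (hWd : ∃ C : VariableChange ℚ, C • W.quadraticTwist (discr K : ℚ) = Wd) :
    Nat.card (Wd.selmerGroup 2) ∣ 2 * Nat.card (W.selmerGroup 2) ∧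
      Nat.card (W.selmerGroup 2) ∣ 2 * Nat.card (Wd.selmerGroup 2) ∧
      ¬ IsSquare (Nat.card (Wd.selmerGroup 2) * Nat.card (W.selmerGroup 2)) := by
  haveI := Fact.mk hℓ
  have hℓd : (ℓ : ℤ) ∣ discr K := ⟨-1, by rw [hd]; ring⟩
  have h := prop33_twin_of_rootCount W h33 hΔ hK hodd hH h2K {ℓ}
    (fun p hp => by
      rw [Finset.mem_singleton] at hp
      subst hp
      exact ⟨hℓ, hℓd, existsUnique_zmod_root_of_discr_eq_neg_prime_of_Δ_neg W hK hodd hH hd hΔ⟩)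
    (fun p hp hpd hpT => by
      exfalso
      refine hpT (Finset.mem_singleton.mpr ?_)
      have h1 : (p : ℤ) ∣ (ℓ : ℤ) := by rw [hd] at hpd; exact dvd_neg.mp hpd
      exact (Nat.prime_dvd_prime_iff_eq hp hℓ).mp (by exact_mod_cast h1))
    Wd hWd
  rw [Finset.card_singleton, pow_one] at h
  refine ⟨h.1, h.2.1, fun hsq => ?_⟩
  exact Nat.not_even_one (h.2.2.mpr hsq)

/-- **`#Sel₂(E) = 1 ⟹ #Sel₂(E^{(−ℓ)}) = 2` for every prime Heegner field `ℚ(√−ℓ)` with `2` split, on `Δ < 0`**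
(mod `MazurRubin2010.prop33_rat`): on the cell {Δ_E < 0, Ш(E)[2] = 0, E(ℚ)[2] = 0} the DEF = 1 Sel₂-MINIMAL twin is supplied
by ANY such field. [cite: MazurRubin2010, Prop. 3.3 and Cor. 3.4 (i)] -/
theorem natCard_selmerGroup_twin_eq_two_of_prime_heegner (h33 : MazurRubin2010.prop33_rat) (hΔ : W.Δ < 0)
    (hK : IsImaginaryQuadratic K) (hodd : Odd (discr K)) (hH : SatisfiesHeegnerHypothesis (W.conductorNorm ℤ) K)
    (h2K : ((Ideal.span {(2 : ℤ)}).primesOver (𝓞 K)).ncard = 2) {ℓ : ℕ} (hℓ : ℓ.Prime) (hd : discr K = -(ℓ : ℤ))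
    (Wd : WeierstrassCurve ℚ) [Wd.IsElliptic]
    (hWd : ∃ C : VariableChange ℚ, C • W.quadraticTwist (discr K : ℚ) = Wd)
    (h1 : Nat.card (W.selmerGroup 2) = 1) : Nat.card (Wd.selmerGroup 2) = 2 := by
  obtain ⟨hdvd, -, hnsq⟩ := selmer_twin_prime_heegner W h33 hΔ hK hodd hH h2K hℓ hd Wd hWd
  rw [h1, mul_one] at hdvd hnsq
  have hle : Nat.card (Wd.selmerGroup 2) ≤ 2 := Nat.le_of_dvd two_pos hdvd
  interval_cases h : Nat.card (Wd.selmerGroup 2)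
  · exact absurd ⟨0, rfl⟩ hnsq
  · exact absurd ⟨1, rfl⟩ hnsq
  · rfl

/-- **`#Sel₂(E^{(−ℓ)}) = 2 ⟹ #Sel₂(E) ∈ {1, 4}`** for a prime Heegner field with `2` split on `Δ < 0`
(mod `MazurRubin2010.prop33_rat`): a DEF = 1 Sel₂-minimal genus pair forces `#Sel₂(E) ≤ 4` — the Selmer reach of the
«DEF = 1» re-typing of the line with a Sel₂-minimal twin is `Ш(E)[2]·E(ℚ)[2]² ⊆ (ℤ/2)²`.
[cite: MazurRubin2010, Prop. 3.3 and Cor. 3.4 (i)] -/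
theorem natCard_selmerGroup_eq_one_or_four_of_prime_heegner_twin (h33 : MazurRubin2010.prop33_rat) (hΔ : W.Δ < 0)
    (hK : IsImaginaryQuadratic K) (hodd : Odd (discr K)) (hH : SatisfiesHeegnerHypothesis (W.conductorNorm ℤ) K)
    (h2K : ((Ideal.span {(2 : ℤ)}).primesOver (𝓞 K)).ncard = 2) {ℓ : ℕ} (hℓ : ℓ.Prime) (hd : discr K = -(ℓ : ℤ))
    (Wd : WeierstrassCurve ℚ) [Wd.IsElliptic]
    (hWd : ∃ C : VariableChange ℚ, C • W.quadraticTwist (discr K : ℚ) = Wd)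
    (h2 : Nat.card (Wd.selmerGroup 2) = 2) : Nat.card (W.selmerGroup 2) = 1 ∨ Nat.card (W.selmerGroup 2) = 4 := by
  obtain ⟨-, hdvd, hnsq⟩ := selmer_twin_prime_heegner W h33 hΔ hK hodd hH h2K hℓ hd Wd hWd
  rw [h2] at hdvd hnsq
  have hle : Nat.card (W.selmerGroup 2) ≤ 4 := Nat.le_of_dvd (by norm_num) hdvd
  interval_cases h : Nat.card (W.selmerGroup 2)
  · exact absurd ⟨0, rfl⟩ hnsq
  · exact Or.inl rfl
  · exact absurd ⟨2, rfl⟩ hnsq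
  · exact absurd hdvd (by decide)
  · exact Or.inr rfl

/-! ## §4. Existence of prime Heegner fields with every side clause of crux 22136 -/

omit [W.IsGloballyMinimal] in
/-- A nonzero rational with ODD `q`-adic valuation at some prime `q` is not a square in `ℚ`. [folklore] -/
private theorem not_isSquare_of_padicValRat_odd {q : ℕ} [Fact q.Prime] {x : ℚ} (hx : x ≠ 0)
    (hodd : Odd (padicValRat q x)) : ¬ IsSquare x := by
  rintro ⟨y, rfl⟩
  have hy : y ≠ 0 := fun h => hx (by rw [h, mul_zero])
  rw [padicValRat.mul hy hy, ← two_mul] at hodd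
  exact (Int.not_odd_iff_even.mpr (even_two_mul _)) hodd

/-- **Prime Heegner fields with all (H2) side clauses exist beyond every bound** (unconditional; Dirichlet + the
decomposition law). For `W/ℚ` globally minimal elliptic and every `n` there are a prime `ℓ > n`, `ℓ ≡ 7 (mod 8)`,
`ℓ ∤ Δ_min(W)`, and an imaginary quadratic field `K` with `d_K = −ℓ` (odd, `≠ −3`), Heegner for `N_W`, `2` split in `K`,
and `d_K·(−|Δ_W|)`, `d_K·(−2|Δ_W|)` non-squares in `ℚ` (their `ℓ`-adic valuation is `1`). [cite: GrossLMS1991, §1 (p. 235)] -/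
theorem exists_prime_heegnerField (n : ℕ) :
    ∃ (K : Type) (_ : Field K) (_ : NumberField K) (ℓ : ℕ), ℓ.Prime ∧ n < ℓ ∧ ℓ % 8 = 7 ∧
      ¬ (ℓ : ℤ) ∣ minimalDiscriminantInt W ∧ IsImaginaryQuadratic K ∧ discr K = -(ℓ : ℤ) ∧ Odd (discr K) ∧
      discr K ≠ -3 ∧ SatisfiesHeegnerHypothesis (W.conductorNorm ℤ) K ∧
      ((Ideal.span {(2 : ℤ)}).primesOver (𝓞 K)).ncard = 2 ∧
      ¬ IsSquare ((discr K : ℚ) * -|W.Δ|) ∧ ¬ IsSquare ((discr K : ℚ) * (-(2 * |W.Δ|))) := by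
  have hN0 : W.conductorNorm ℤ ≠ 0 := (W.conductorNorm_pos_holds).ne'
  have hΔ0 : minimalDiscriminantInt W ≠ 0 := minimalDiscriminantInt_ne_zero W
  obtain ⟨K, _, _, ℓ, h2K, htc, hℓ, hℓn, -, hℓ8, hd, hsplit, -⟩ :=
    Quadratic.exists_imaginaryQuadratic_forall_split (insert 2 (W.conductorNorm ℤ).primeFactors)
      (max n (max 3 (minimalDiscriminantInt W).natAbs))
  haveI := Fact.mk hℓ
  have hℓn' : n < ℓ := lt_of_le_of_lt (le_max_left _ _) hℓn
  have hℓ3 : 3 < ℓ := lt_of_le_of_lt ((le_max_left _ _).trans (le_max_right _ _)) hℓn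
  have hℓΔabs : (minimalDiscriminantInt W).natAbs < ℓ := lt_of_le_of_lt ((le_max_right _ _).trans (le_max_right _ _)) hℓn
  have hℓΔ : ¬ (ℓ : ℤ) ∣ minimalDiscriminantInt W := by
    intro h
    have h' : ℓ ∣ (minimalDiscriminantInt W).natAbs := Int.natCast_dvd.mp h
    have := Nat.le_of_dvd (Int.natAbs_pos.mpr hΔ0) h'
    omega
  have hK : IsImaginaryQuadratic K := ⟨h2K, htc⟩
  have hoddK : Odd (discr K) := by rw [hd, Int.odd_iff]; omega
  have hH : SatisfiesHeegnerHypothesis (W.conductorNorm ℤ) K := fun p hp hpN =>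
    hsplit p (Finset.mem_insert_of_mem (Nat.mem_primeFactors.mpr ⟨hp, hpN, hN0⟩)) hp
  have h2split : ((Ideal.span {(2 : ℤ)}).primesOver (𝓞 K)).ncard = 2 := by
    exact_mod_cast hsplit 2 (Finset.mem_insert_self _ _) Nat.prime_two
  -- `ℓ`-adic valuations
  have hℓQ : (ℓ : ℚ) ≠ 0 := by exact_mod_cast hℓ.ne_zero
  have hΔQ : (W.Δ : ℚ) ≠ 0 := W.isUnit_Δ.ne_zero
  have hvΔ : padicValRat ℓ W.Δ = 0 := by
    rw [← cast_minimalDiscriminantInt W, padicValRat.of_int, Int.natCast_eq_zero,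
      padicValInt.eq_zero_of_not_dvd hℓΔ]
  have hvΔabs : padicValRat ℓ |W.Δ| = 0 := by
    rcases abs_choice W.Δ with h | h
    · rw [h, hvΔ]
    · rw [h, padicValRat.neg, hvΔ]
  have hv2 : padicValRat ℓ (2 : ℚ) = 0 := by
    have h2 : ¬ ℓ ∣ 2 := fun h => by have := Nat.le_of_dvd two_pos h; omega
    rw [show (2 : ℚ) = ((2 : ℕ) : ℚ) by norm_num, padicValRat.of_nat, padicValNat.eq_zero_of_not_dvd h2,
      Nat.cast_zero]
  have hy0 : (ℓ : ℚ) * |W.Δ| ≠ 0 := mul_ne_zero hℓQ (abs_ne_zero.mpr hΔQ)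
  have hy : padicValRat ℓ ((ℓ : ℚ) * |W.Δ|) = 1 := by
    rw [padicValRat.mul hℓQ (abs_ne_zero.mpr hΔQ), padicValRat.self hℓ.one_lt, hvΔabs, add_zero]
  refine ⟨K, inferInstance, inferInstance, ℓ, hℓ, hℓn', hℓ8, hℓΔ, hK, hd, hoddK, by rw [hd]; omega, hH, h2split, ?_, ?_⟩
  · have hx : ((discr K : ℤ) : ℚ) * -|W.Δ| = (ℓ : ℚ) * |W.Δ| := by rw [hd]; push_cast; ring
    rw [hx]
    exact not_isSquare_of_padicValRat_odd (q := ℓ) hy0 (by rw [hy]; exact odd_one)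
  · have hx : ((discr K : ℤ) : ℚ) * (-(2 * |W.Δ|)) = 2 * ((ℓ : ℚ) * |W.Δ|) := by rw [hd]; push_cast; ring
    rw [hx]
    refine not_isSquare_of_padicValRat_odd (q := ℓ) (mul_ne_zero two_ne_zero hy0) ?_
    rw [padicValRat.mul two_ne_zero hy0, hy, hv2, zero_add]
    exact odd_one

/-- **SUPPLY″-Selmer on the cell {Δ < 0, #Sel₂(E) = 1}, modulo Mazur–Rubin Prop. 3.3 (PRINT) only.** For `W/ℚ` globally
minimal elliptic with `Δ_W < 0` and `#Sel₂(W) = 1` (i.e. `Ш(E)[2] = 0` and `E(ℚ)[2] = 0`), beyond every bound `n` there is a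
PRIME Heegner field `K = ℚ(√−ℓ)` (`ℓ > n`) carrying ALL the K-clauses of crux 22136 (imaginary quadratic, `d_K` odd,
`d_K ≠ −3`, Heegner for `N_W`, `d_K·(−|Δ|)`, `d_K·(−2|Δ|)` non-squares), `2` split, DEF(W,K) = 1 (its one prime is a
transposition prime), together with a GLOBALLY MINIMAL model `Wd` of `W^{(d_K)}` with `#Sel₂(Wd) = 2`. (The twin's analytic
rank one is not asserted: it is the rank-one `2`-converse / Gross–Zagier–Kolyvagin input of the line.)
[cite: MazurRubin2010, Prop. 3.3 and Cor. 3.4 (i)] [cite: GrossLMS1991, §1 (p. 235)] -/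
theorem exists_prime_heegnerField_minimalTwin_of_prop33 (h33 : MazurRubin2010.prop33_rat) (hΔ : W.Δ < 0)
    (h1 : Nat.card (W.selmerGroup 2) = 1) (n : ℕ) :
    ∃ (K : Type) (_ : Field K) (_ : NumberField K) (ℓ : ℕ), ℓ.Prime ∧ n < ℓ ∧
      IsImaginaryQuadratic K ∧ discr K = -(ℓ : ℤ) ∧ Odd (discr K) ∧ discr K ≠ -3 ∧
      SatisfiesHeegnerHypothesis (W.conductorNorm ℤ) K ∧
      ¬ IsSquare ((discr K : ℚ) * -|W.Δ|) ∧ ¬ IsSquare ((discr K : ℚ) * (-(2 * |W.Δ|))) ∧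
      ((Ideal.span {(2 : ℤ)}).primesOver (𝓞 K)).ncard = 2 ∧
      (∃! x : ZMod ℓ, 4 * x ^ 3 + ((integralModelInt W).b₂ : ZMod ℓ) * x ^ 2 +
        2 * ((integralModelInt W).b₄ : ZMod ℓ) * x + ((integralModelInt W).b₆ : ZMod ℓ) = 0) ∧
      ∃ (Wd : WeierstrassCurve ℚ) (_ : Wd.IsElliptic) (_ : Wd.IsGloballyMinimal),
        (∃ C : VariableChange ℚ, C • W.quadraticTwist (discr K : ℚ) = Wd) ∧ Nat.card (Wd.selmerGroup 2) = 2 := by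
  obtain ⟨K, _, _, ℓ, hℓ, hℓn, -, -, hK, hd, hodd, hd3, hH, h2K, hsq1, hsq2⟩ := exists_prime_heegnerField W n
  haveI := Fact.mk hℓ
  -- a globally minimal model of the twist
  have hd0 : ((discr K : ℤ) : ℚ) ≠ 0 := by exact_mod_cast NumberField.discr_ne_zero K
  haveI := W.isElliptic_quadraticTwist hd0
  obtain ⟨C, hC⟩ := hasGlobalMinimalModel_rat_holds (W.quadraticTwist ((discr K : ℤ) : ℚ))
  haveI := hC
  refine ⟨K, inferInstance, inferInstance, ℓ, hℓ, hℓn, hK, hd, hodd, hd3, hH, hsq1, hsq2, h2K,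
    existsUnique_zmod_root_of_discr_eq_neg_prime_of_Δ_neg W hK hodd hH hd hΔ,
    C • W.quadraticTwist ((discr K : ℤ) : ℚ), inferInstance, hC, ⟨C, rfl⟩, ?_⟩
  exact natCard_selmerGroup_twin_eq_two_of_prime_heegner W h33 hΔ hK hodd hH h2K hℓ hd _ ⟨C, rfl⟩ h1

end Summit.BirchSwinnertonDyer.BirchSwinnertonDyer.Theorems.GenusKolyTwin
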